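import Mathlib.Algebra.BigOperators.Intervals
import Mathlib.Algebra.Order.BigOperators.Ring.Finset
import Mathlib.Analysis.SpecialFunctions.Pow.Real
import HarnessLib

/-!
# The super-terminal quartic law `V4` on 4-terminal hub graphs — the algebraic core (THEOREM H4, part 1/3)

Support file for crux `stmt-CriticalPhenomena-4575` (`NoHeavyLowerTail`), seat `prim-facecert` gen 21 (`--supports stmt-CriticalPhenomena-4575`);
memo `run/shared/lean/prim/prim-l12/prim-facecert/FINDING-gen21-V4-HUB-GRAPHS.md`.  No definitions, no sorries, standard axioms.

THEOREM H4 (memo): the super-terminal quartic law `V4`, `Q⁴ ≤ A²·B²·C` (the hypothesis of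
`SuperTerminalQuarticFace.p3_half_of_superTerminalQuartic`), holds on every finite weighted graph in which the four points `c, s, a, b` form a
vertex cover (all 4-terminal hub graphs `K_{4,k}`, every `k`, arbitrary weights, plus terminal–terminal pairs).  The partition of `{c,s,a,b}` is then the
join of independent PIECE partitions, all down-set masses are products over pieces, and the proof is a telescoping / disjoint-events / Cauchy–Schwarz
argument driven by three ONE-PIECE inequalities.  This file is the measure-free algebraic core, phrased as an INDUCTION over pieces so that no
definitions are needed:

* `step` — one piece is appended.  State `(Q, A, Bt, X0, Y0, E, V)` (the masses `Q = P(sa|b|c)`, `A = P(F, c∤S)`, the disjoint-events lower bound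
  `Bt ≤ B = P(F, c≁b)`, `X0 = P(0̂)`, `Y0 = P(≤ s|a|bc)`, `E = Π(n+e)`, `V = Π √γ`) and a piece `(n, p, d, f, e, cre, mB, v)` satisfying the one-piece
  inequalities `p² ≤ (p+f)·cre·v`, `n² ≤ (n+d)(n+e)·v`, `(n+p)² ≤ (n+p+d+f)·mB·v`; the invariant `Q² ≤ V·A·Bt ∧ X0² ≤ V·Y0·E` is preserved
  under `Q' = Q(n+p) + p·X0`, `A' = A(n+p+d+f) + (p+f)·Y0`, `Bt' = Bt·mB + cre·E`, `X0' = X0·n`, `Y0' = Y0(n+d)`, `E' = E(n+e)`, `V' = V·v`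
  (AM–GM on the cross term — this is where Cauchy–Schwarz happens).
* `invariant_range` — the invariant for every `k`, for pieces indexed by `ℕ` (products over `Finset.range k`; `Bt` written out as the telescoped sum
  `Σ_{j<k} cre_j · Π_{i<j}(n_i+e_i) · Π_{j<i<k} mB_i`).
* `superTerminalQuartic_of_invariant` — packaging: `Q² ≤ V·A·Bt`, `Bt ≤ B`, `V² = C` give `Q⁴ ≤ A²·B²·C`.
Parts 2/3 (`…SuperTerminalQuarticOneHub`: the one-piece inequalities for a hub with independent attachments, exact Bernstein certificates) and 3/3
(the `prodBernoulli` bridge) are separate files.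
-/

namespace Summit.CriticalPhenomena.PercolationContinuityZ3.Theorems.SuperTerminalQuarticHubAlgebra

open Finset

/-- AM–GM packaging of the Cauchy–Schwarz cross term: if `x² ≤ U₁`, `y² ≤ U₂` with `x, y ≥ 0` and `U₁·U₂ = u·w` with `u, w ≥ 0`,
then `2xy ≤ u + w`. [this work] -/
theorem two_mul_le_add_of_sq_le {x y U₁ U₂ u w : ℝ} (hx : 0 ≤ x) (hy : 0 ≤ y) (hu : 0 ≤ u) (hw : 0 ≤ w)
    (h1 : x ^ 2 ≤ U₁) (h2 : y ^ 2 ≤ U₂) (huw : U₁ * U₂ = u * w) : 2 * x * y ≤ u + w := by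
  have hU1 : 0 ≤ U₁ := le_trans (sq_nonneg x) h1
  have hprod : (x * y) ^ 2 ≤ u * w := by
    calc (x * y) ^ 2 = x ^ 2 * y ^ 2 := by ring
      _ ≤ U₁ * U₂ := mul_le_mul h1 h2 (sq_nonneg y) hU1
      _ = u * w := huw
  have hsq : (2 * x * y) ^ 2 ≤ (u + w) ^ 2 := by nlinarith [sq_nonneg (u - w)]
  have h2xy : 0 ≤ 2 * x * y := by positivity
  exact (pow_le_pow_iff_left₀ h2xy (by positivity) two_ne_zero).1 hsq

/-- **One piece appended (the induction step of THEOREM H4).**  See the module docstring for the meaning of the letters. [this work] -/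
theorem step {Q A Bt X0 Y0 E V n p d f e cre mB v : ℝ}
    (hQ : 0 ≤ Q) (hA : 0 ≤ A) (hBt : 0 ≤ Bt) (hX0 : 0 ≤ X0) (hY0 : 0 ≤ Y0) (hE : 0 ≤ E) (hV : 0 ≤ V)
    (hn : 0 ≤ n) (hp : 0 ≤ p) (hd : 0 ≤ d) (hf : 0 ≤ f) (hcre : 0 ≤ cre) (hmB : 0 ≤ mB) (hv : 0 ≤ v)
    (hIQ : Q ^ 2 ≤ V * A * Bt) (hIX : X0 ^ 2 ≤ V * Y0 * E)
    (hpe : p ^ 2 ≤ (p + f) * cre * v) (hlt : n ^ 2 ≤ (n + d) * (n + e) * v) (hgt : (n + p) ^ 2 ≤ (n + p + d + f) * mB * v) :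
    (Q * (n + p) + p * X0) ^ 2 ≤ (V * v) * (A * (n + p + d + f) + (p + f) * Y0) * (Bt * mB + cre * E) ∧
      (X0 * n) ^ 2 ≤ (V * v) * (Y0 * (n + d)) * (E * (n + e)) := by
  constructor
  · -- the three bounds: diagonal terms by products of the hypotheses, cross term by AM–GM
    have hVABt : 0 ≤ V * A * Bt := by positivity
    have hVYE : 0 ≤ V * Y0 * E := by positivity
    have h1 : (Q * (n + p)) ^ 2 ≤ (V * A * Bt) * ((n + p + d + f) * mB * v) := by
      calc (Q * (n + p)) ^ 2 = Q ^ 2 * (n + p) ^ 2 := by ring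
        _ ≤ (V * A * Bt) * ((n + p + d + f) * mB * v) := mul_le_mul hIQ hgt (sq_nonneg _) hVABt
    have h2 : (p * X0) ^ 2 ≤ ((p + f) * cre * v) * (V * Y0 * E) := by
      calc (p * X0) ^ 2 = p ^ 2 * X0 ^ 2 := by ring
        _ ≤ ((p + f) * cre * v) * (V * Y0 * E) := mul_le_mul hpe hIX (sq_nonneg _) (by positivity)
    have hcross : 2 * (Q * (n + p)) * (p * X0) ≤
        V * v * (A * (n + p + d + f)) * (cre * E) + V * v * ((p + f) * Y0) * (Bt * mB) :=
      two_mul_le_add_of_sq_le (by positivity) (by positivity) (by positivity) (by positivity) h1 h2 (by ring)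
    have hexp : (Q * (n + p) + p * X0) ^ 2 =
        (Q * (n + p)) ^ 2 + 2 * (Q * (n + p)) * (p * X0) + (p * X0) ^ 2 := by ring
    have hrhs : (V * v) * (A * (n + p + d + f) + (p + f) * Y0) * (Bt * mB + cre * E) =
        (V * A * Bt) * ((n + p + d + f) * mB * v) +
          (V * v * (A * (n + p + d + f)) * (cre * E) + V * v * ((p + f) * Y0) * (Bt * mB)) +
          ((p + f) * cre * v) * (V * Y0 * E) := by ring
    rw [hexp, hrhs]
    linarith
  · calc (X0 * n) ^ 2 = X0 ^ 2 * n ^ 2 := by ring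
      _ ≤ (V * Y0 * E) * ((n + d) * (n + e) * v) := mul_le_mul hIX hlt (sq_nonneg _) (by positivity)
      _ = (V * v) * (Y0 * (n + d)) * (E * (n + e)) := by ring

/-- **The invariant for every number of pieces** (pieces indexed by `ℕ`, the first `k` used; products over `Finset.range k`).
Hypotheses: nonnegativity and the three one-piece inequalities for every index `i < k`.  Conclusion:
`(Π(n+p) − Πn)² ≤ (Π v)·(Π(n+p+d+f) − Π(n+d))·Bt_k` with `Bt_k = Σ_{j<k} cre_j·Π_{i<j}(n_i+e_i)·Π_{j<i<k} mB_i`, together with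
`(Π n)² ≤ (Π v)(Π(n+d))(Π(n+e))`. [this work] -/
theorem invariant_range (n p d f e cre mB v : ℕ → ℝ) (k : ℕ)
    (hn : ∀ i < k, 0 ≤ n i) (hp : ∀ i < k, 0 ≤ p i) (hd : ∀ i < k, 0 ≤ d i) (hf : ∀ i < k, 0 ≤ f i) (he : ∀ i < k, 0 ≤ e i)
    (hcre : ∀ i < k, 0 ≤ cre i) (hmB : ∀ i < k, 0 ≤ mB i) (hv : ∀ i < k, 0 ≤ v i)
    (hpe : ∀ i < k, p i ^ 2 ≤ (p i + f i) * cre i * v i)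
    (hlt : ∀ i < k, n i ^ 2 ≤ (n i + d i) * (n i + e i) * v i)
    (hgt : ∀ i < k, (n i + p i) ^ 2 ≤ (n i + p i + d i + f i) * mB i * v i) :
    (∏ i ∈ range k, (n i + p i) - ∏ i ∈ range k, n i) ^ 2 ≤
        (∏ i ∈ range k, v i) * (∏ i ∈ range k, (n i + p i + d i + f i) - ∏ i ∈ range k, (n i + d i)) *
          (∑ j ∈ range k, cre j * (∏ i ∈ range j, (n i + e i)) * ∏ i ∈ Ico (j + 1) k, mB i) ∧
      (∏ i ∈ range k, n i) ^ 2 ≤ (∏ i ∈ range k, v i) * (∏ i ∈ range k, (n i + d i)) * ∏ i ∈ range k, (n i + e i) := by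
  induction k with
  | zero => simp
  | succ k ih =>
    -- restrict the hypotheses and apply the induction hypothesis
    have hk : ∀ {P : ℕ → Prop}, (∀ i < k + 1, P i) → ∀ i < k, P i := fun h i hi => h i (Nat.lt_succ_of_lt hi)
    obtain ⟨ihQ, ihX⟩ := ih (hk hn) (hk hp) (hk hd) (hk hf) (hk he) (hk hcre) (hk hmB) (hk hv) (hk hpe) (hk hlt) (hk hgt)
    have hkk : k < k + 1 := Nat.lt_succ_self k
    -- nonnegativity of the running quantities
    have hk'' : ∀ {i}, i ∈ range k → i < k + 1 := fun hi => Nat.lt_succ_of_lt (mem_range.1 hi)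
    have hX0 : 0 ≤ ∏ i ∈ range k, n i := prod_nonneg fun i hi => hn i (hk'' hi)
    have hXp : 0 ≤ ∏ i ∈ range k, (n i + p i) := prod_nonneg fun i hi => add_nonneg (hn i (hk'' hi)) (hp i (hk'' hi))
    have hY0 : 0 ≤ ∏ i ∈ range k, (n i + d i) := prod_nonneg fun i hi => add_nonneg (hn i (hk'' hi)) (hd i (hk'' hi))
    have hE : 0 ≤ ∏ i ∈ range k, (n i + e i) := prod_nonneg fun i hi => add_nonneg (hn i (hk'' hi)) (he i (hk'' hi))
    have hV : 0 ≤ ∏ i ∈ range k, v i := prod_nonneg fun i hi => hv i (hk'' hi)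
    have hBt : 0 ≤ ∑ j ∈ range k, cre j * (∏ i ∈ range j, (n i + e i)) * ∏ i ∈ Ico (j + 1) k, mB i := by
      refine sum_nonneg fun j hj => ?_
      have hj' : j < k := mem_range.1 hj
      refine mul_nonneg (mul_nonneg (hcre j (Nat.lt_succ_of_lt hj')) (prod_nonneg fun i hi => ?_)) (prod_nonneg fun i hi => ?_)
      · have : i < j := mem_range.1 hi
        exact add_nonneg (hn i (by omega)) (he i (by omega))
      · have : i < k := (mem_Ico.1 hi).2
        exact hmB i (by omega)
    -- `Q ≥ 0` and `A ≥ 0`: the products are monotone in the factors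
    have hQ : 0 ≤ ∏ i ∈ range k, (n i + p i) - ∏ i ∈ range k, n i := by
      refine sub_nonneg.2 (prod_le_prod (fun i hi => hn i (hk'' hi)) fun i hi => ?_)
      linarith [hp i (hk'' hi)]
    have hA : 0 ≤ ∏ i ∈ range k, (n i + p i + d i + f i) - ∏ i ∈ range k, (n i + d i) := by
      refine sub_nonneg.2 (prod_le_prod (fun i hi => add_nonneg (hn i (hk'' hi)) (hd i (hk'' hi))) fun i hi => ?_)
      linarith [hp i (hk'' hi), hf i (hk'' hi)]
    have H := step hQ hA hBt hX0 hY0 hE hV (hn k hkk) (hp k hkk) (hd k hkk) (hf k hkk) (hcre k hkk) (hmB k hkk)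
      (hv k hkk) ihQ ihX (hpe k hkk) (hlt k hkk) (hgt k hkk)
    -- rewrite the `k+1` quantities in terms of the `k` quantities
    have eBt : (∑ j ∈ range (k + 1), cre j * (∏ i ∈ range j, (n i + e i)) * ∏ i ∈ Ico (j + 1) (k + 1), mB i) =
        (∑ j ∈ range k, cre j * (∏ i ∈ range j, (n i + e i)) * ∏ i ∈ Ico (j + 1) k, mB i) * mB k +
          cre k * ∏ i ∈ range k, (n i + e i) := by
      rw [sum_range_succ, Ico_self, prod_empty, mul_one, sum_mul]
      congr 1
      refine sum_congr rfl fun j hj => ?_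
      have hj : j + 1 ≤ k := mem_range.1 hj
      rw [prod_Ico_succ_top hj]
      ring
    rw [eBt]
    simp only [prod_range_succ]
    constructor
    · convert H.1 using 1 <;> ring
    · exact H.2

/-- **Packaging.**  From the invariant `Q² ≤ V·A·Bt`, the disjoint-events bound `Bt ≤ B` and `V² = C` (with `A, Bt ≥ 0`):
the super-terminal quartic law `Q⁴ ≤ A²·B²·C`. [this work] -/
theorem superTerminalQuartic_of_invariant {Q A B Bt C V : ℝ} (hA : 0 ≤ A) (hBt : 0 ≤ Bt) (hBtB : Bt ≤ B) (hV : 0 ≤ V)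
    (hC : V ^ 2 = C) (hI : Q ^ 2 ≤ V * A * Bt) : Q ^ 4 ≤ A ^ 2 * B ^ 2 * C := by
  have h0 : 0 ≤ V * A * Bt := by positivity
  have h4 : Q ^ 4 ≤ (V * A * Bt) ^ 2 := by
    calc Q ^ 4 = (Q ^ 2) ^ 2 := by ring
      _ ≤ (V * A * Bt) ^ 2 := pow_le_pow_left₀ (sq_nonneg Q) hI 2
  have hB : 0 ≤ B := le_trans hBt hBtB
  have h5 : (V * A * Bt) ^ 2 ≤ (V * A * B) ^ 2 :=
    pow_le_pow_left₀ h0 (mul_le_mul_of_nonneg_left hBtB (by positivity)) 2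
  calc Q ^ 4 ≤ (V * A * Bt) ^ 2 := h4
    _ ≤ (V * A * B) ^ 2 := h5
    _ = A ^ 2 * B ^ 2 * C := by rw [← hC]; ring

end Summit.CriticalPhenomena.PercolationContinuityZ3.Theorems.SuperTerminalQuarticHubAlgebra
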